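import Literature.AnabelianGeometry.AbsoluteAnabelian.AbsTopIProp410GraphSurjectivityProofs
import Literature.AnabelianGeometry.AbsoluteAnabelian.AbsTopIProp410AtProofs
import Literature.AnabelianGeometry.SemiGraphs.TemperedOriginGenuineNonVacuity
import Mathlib.SetTheory.Cardinal.Free
import HarnessLib

/-!
# [AbsTopI] Prop 4.10 (iii) at the construction: the COMPACT case is unconditional (proof-only)

S. Mochizuki, *Topics in Absolute Anabelian Geometry I: Generalities* [AbsTopI] (J. Math. Sci.
Univ. Tokyo 19 (2012)), §0 p. 8 (co-free subgroups, minimal co-free subgroups, the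
`(Q, Δ)`-co-free completion) and Prop 4.10 (iii) p. 60 ("the natural homomorphism `Π^tp_X → Π^tp_Y`
[...] may be reconstructed [...] from its profinite completion `Π̂^tp_X ↠ Π̂^tp_Y` [...] as the natural
morphism from `Π^tp_X` [...] to the co-free completion of `Π^tp_X` with respect to `Π̂^tp_Y`");
manuscript pagination, lit key `paper:url-11ac98ba15fc`, read on the page.

Context: node AbsTopI:Prop4.10(iii) of the cell's sub-DAG `HOME/plan/L4/SUBDAG-AbsTopI-Prop410.md`.
The closers of record `prop410iiiAt_of_geometric_residues` / `prop410iiiDeltaAt_of_geometric_residues`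
(`AbsTopIProp410GraphSurjectivityProofs.lean`) prove BOTH clauses of the node AT THE CONSTRUCTION
over exactly FIVE residues: (CF_Δ) André's basis clause on `Δ^tp_Y`, conj. 1 `hleft` of
`CoFreeCofinalImAlong`, topological finite generation of `Δ^tp_X`, the L3 parameter bundles
`dX`, `dY : GroupLevelData`, and §0 p. 8's standing hypothesis `hmin` (minimal co-free subgroups
exist for every Y-index).

THIS FILE proves that in the COMPACT regime — `Π^tp_X` compact, equivalently `Π^tp_X → Π̂_X`
bijective (then `f`, `Π^tp_Y = f(Π^tp_X)` and `Δ^tp_Y = f(Δ^tp_X)` are compact too) — the three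
non-parameter residues are THEOREMS of general topology:
* `hmin`: a compact `H′` is its own minimal co-free subgroup — an open co-free `K ≤ H′` has a
  quotient `H′/K` that is finite AND free, hence trivial (`le_of_isCofreeIn_of_isCompact`,
  `cofreeCore_eq_self_of_isCompact`);
* (CF_Δ): the characteristic open subgroups of the compact, topologically finitely generated
  `Δ^tp_Y` form a basis of neighbourhoods of `1` (the tree's `CharOpenSubgroup.exists_le`,
  [AbsTopI] §0 p. 9), and `H′^{co-fr} ≤ H′`;
* conj. 1 `hleft`: `K_X(H) ⊇ f̂(toHat_X(H^{co-fr})) = toHat_Y(f(H))` and `f(H) ≤ Δ^tp_Y` is closed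
  of finite index, hence open, hence contains a Y-index `H′` — whose kernel `K_Y(H′)` is then
  `≤ K_X(H)`.
Whence **`prop410iiiAt_of_compactSpace` / `prop410iiiDeltaAt_of_compactSpace`**: node (iii), both
clauses, at the construction, over {`CompactSpace Π^tp_X`, tfg `Δ^tp_X`, `dX`, `dY`} ONLY.

HONEST READING: in the compact (profinite) regime every "dual graph" is a tree (`H^{co-fr} = H`),
the co-free completion of `Π^tp_X = Π̂_X` with respect to `Π̂_Y` is `Π̂_Y` itself, and (iii) carries
no content beyond `Π̂_X ↠ Π̂_Y`; the five residues of the general closers therefore measure exactly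
the NON-compactness of genuine tempered fundamental groups (infinite dual graphs).  This file is the
degenerate-case half of the node and the engine of the cell's inhabitation witness for it
(companion `AbsTopIProp410CompactModelNonVacuity.lean`, to follow).  Inputs are hypotheses stated in the
signatures (no new named facts; FACT-LIST untouched).  Refereed prerequisite paper; nothing here
bears on [IUTchIII] Cor 3.12; typed ≠ proved.
-/

noncomputable section

open _root_.Topology Filter

namespace Literature.AnabelianGeometry.AbsoluteAnabelian.AbsTopI

/-! ### A compact subgroup is its own minimal co-free subgroup -/

section Compact

variable {P : Type*} [Group P] [TopologicalSpace P] [IsTopologicalGroup P]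

/-- A finite free group is trivial (a free group on a nonempty set of generators is infinite).
[cite: MochizukiAbsTopI2012, §0 p.8] -/
private theorem subsingleton_of_isFreeGroup_of_finite_aux (G : Type*) [Group G] [IsFreeGroup G]
    [Finite G] : Subsingleton G := by
  rcases isEmpty_or_nonempty (IsFreeGroup.Generators G) with hE | hE
  · haveI : Unique (FreeGroup (IsFreeGroup.Generators G)) := inferInstance
    exact (IsFreeGroup.toFreeGroup G).toEquiv.subsingleton
  · haveI : Infinite (FreeGroup (IsFreeGroup.Generators G)) := inferInstance
    haveI : Infinite G := Infinite.of_injective _ (IsFreeGroup.toFreeGroup G).symm.injective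
    exact (not_finite G).elim

/-- **A compact subgroup lies in each of its co-free subgroups** ([AbsTopI] §0 p. 8): a co-free
`K` is open in `H`, so `H/K` is finite, and free, hence trivial. [cite: MochizukiAbsTopI2012, §0 p.8] -/
theorem le_of_isCofreeIn_of_isCompact {H K : Subgroup P} (hH : IsCompact (H : Set P))
    (hK : IsCofreeIn H K) : H ≤ K := by
  obtain ⟨-, hN, hcf⟩ := hK
  haveI : CompactSpace H := isCompact_iff_compactSpace.mp hH
  haveI := hN
  haveI : Finite (H ⧸ K.subgroupOf H) := Subgroup.quotient_finite_of_isOpen _ hcf.isOpen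
  haveI : IsFreeGroup (H ⧸ K.subgroupOf H) := hcf.isFreeGroup_quotient
  haveI : Subsingleton (H ⧸ K.subgroupOf H) := subsingleton_of_isFreeGroup_of_finite_aux _
  intro h hh
  have hmem : (⟨h, hh⟩ : H) ∈ K.subgroupOf H :=
    (QuotientGroup.eq_one_iff (⟨h, hh⟩ : H)).mp (Subsingleton.elim _ _)
  exact Subgroup.mem_subgroupOf.mp hmem

/-- **A compact subgroup is its own minimal co-free subgroup** (`H^{co-fr} = H`: "the dual graph is
a tree"). [cite: MochizukiAbsTopI2012, §0 p.8] -/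
theorem isMinimalCofreeIn_self_of_isCompact {H : Subgroup P} (hH : IsCompact (H : Set P)) :
    IsMinimalCofreeIn H H :=
  ⟨isCofreeIn_self H, fun _ hK => le_of_isCofreeIn_of_isCompact hH hK⟩

/-- The co-free core of a compact subgroup is the subgroup itself. [cite: MochizukiAbsTopI2012, §0 p.8] -/
theorem cofreeCore_eq_self_of_isCompact {H : Subgroup P} (hH : IsCompact (H : Set P)) :
    cofreeCore H = H :=
  cofreeCore_eq_of_isMinimalCofreeIn (isMinimalCofreeIn_self_of_isCompact hH)

/-- An index `H : CharOpenSubgroup Δ` of a COMPACT `Δ` is compact as a subset of the ambient group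
(open in `Δ`, hence closed in `Δ`). [cite: MochizukiAbsTopI2012, §0 p.8] -/
theorem CharOpenSubgroup.isCompact_of_compactSpace {Δ : Subgroup P} [CompactSpace Δ]
    (H : CharOpenSubgroup Δ) : IsCompact (H.toSubgroup : Set P) := by
  have hcl : IsClosed ((H.toSubgroup.subgroupOf Δ : Subgroup Δ) : Set Δ) :=
    Subgroup.isClosed_of_isOpen _ H.isOpen
  have heq : (H.toSubgroup : Set P) =
      Subtype.val '' ((H.toSubgroup.subgroupOf Δ : Subgroup Δ) : Set Δ) := by
    ext g
    constructor
    · intro hg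
      exact ⟨⟨g, H.le hg⟩, Subgroup.mem_subgroupOf.mpr hg, rfl⟩
    · rintro ⟨x, hx, rfl⟩
      exact Subgroup.mem_subgroupOf.mp hx
  rw [heq]
  exact hcl.isCompact.image continuous_subtype_val

/-- In a compact `Δ` every index admits a minimal co-free subgroup — itself (§0 p. 8's standing
hypothesis `hmin` is automatic). [cite: MochizukiAbsTopI2012, §0 p.8] -/
theorem CharOpenSubgroup.exists_isMinimalCofreeIn_of_compactSpace {Δ : Subgroup P} [CompactSpace Δ]
    (H : CharOpenSubgroup Δ) : ∃ M, IsMinimalCofreeIn H.toSubgroup M :=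
  ⟨H.toSubgroup, isMinimalCofreeIn_self_of_isCompact H.isCompact_of_compactSpace⟩

/-- In a compact `Δ`, `H^{co-fr} = H` for every index. [cite: MochizukiAbsTopI2012, §0 p.8] -/
theorem CharOpenSubgroup.cofreeCore_eq_of_compactSpace {Δ : Subgroup P} [CompactSpace Δ]
    (H : CharOpenSubgroup Δ) : cofreeCore H.toSubgroup = H.toSubgroup :=
  cofreeCore_eq_self_of_isCompact H.isCompact_of_compactSpace

/-- **(CF_Δ) in the compact case**: if `Δ` is compact and topologically finitely generated, every
open normal subgroup of `Δ` contains the co-free core of some index ([AbsTopI] §0 p. 9: "the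
topology of `G` admits a basis of characteristic open subgroups"). [cite: MochizukiAbsTopI2012, §0 p.9] -/
theorem cofreeCore_cofinal_of_compactSpace {Δ : Subgroup P} [CompactSpace Δ]
    (htfg : IsTopologicallyFinitelyGenerated Δ) (N : OpenNormalSubgroup Δ) :
    ∃ H' : CharOpenSubgroup Δ, (cofreeCore H'.toSubgroup).subgroupOf Δ ≤ N.toSubgroup := by
  have hV : (N.toSubgroup.map Δ.subtype).subgroupOf Δ = N.toSubgroup :=
    Subgroup.comap_map_eq_self_of_injective Δ.subtype_injective _
  have hVo : IsOpen (((N.toSubgroup.map Δ.subtype).subgroupOf Δ : Subgroup Δ) : Set Δ) := by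
    rw [hV]
    exact N.isOpen
  haveI : Finite (Δ ⧸ N.toSubgroup) := Subgroup.quotient_finite_of_isOpen _ N.isOpen
  haveI : ((N.toSubgroup.map Δ.subtype).subgroupOf Δ).FiniteIndex := by
    rw [hV]
    exact Subgroup.finiteIndex_of_finite_quotient
  obtain ⟨H', hH'⟩ := CharOpenSubgroup.exists_le htfg (N.toSubgroup.map Δ.subtype) hVo
  refine ⟨H', ?_⟩
  rw [← hV]
  exact Subgroup.comap_mono ((cofreeCore_le _).trans hH')

end Compact

namespace Prop410

open Literature.AnabelianGeometry.SemiGraphs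
open Literature.AnabelianGeometry.AbsoluteAnabelian.AbsTopI

variable {p : ℕ} [Fact p.Prime]

/-! ### Tempered curves with compact `Π^tp` (`Π^tp → Π̂` is then onto: the tree's
`TemperedCurve.toHat_surjective_of_compactSpace`; `Δ^tp` closed: `TemperedCurve.isClosed_deltaTemp`) -/

/-- In the compact case `Δ^tp_Z` is compact. [cite: MochizukiSemiAnbd2006, §6 p.69] -/
theorem compactSpace_deltaTemp (Z : TemperedCurve p) [CompactSpace Z.PiTemp] :
    CompactSpace Z.DeltaTemp :=
  isCompact_iff_compactSpace.mp Z.isClosed_deltaTemp.isCompact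

namespace DeCuspidalization

variable {X Y : TemperedCurve p}

/-- **Compact case: `f : Π^tp_X → Π^tp_Y` is surjective** — `toHat_Y(y) = f̂(toHat_X(x)) = toHat_Y(f x)`
and `toHat_Y` is injective. [cite: MochizukiAbsTopI2012, Prop 4.10 (iii) p.60] -/
theorem f_surjective_of_compactSpace (E : DeCuspidalization X Y) [CompactSpace X.PiTemp] : Function.Surjective E.f := by
  intro y
  obtain ⟨xh, hxh⟩ := E.fHat_surjective (Y.toHat y)
  obtain ⟨x, rfl⟩ := X.toHat_surjective_of_compactSpace xh
  refine ⟨x, Y.toHat_injective ?_⟩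
  rw [E.toHat_comp x, hxh]

/-- Compact case: `Δ^tp_X → Δ^tp_Y` is surjective (`f⁻¹(Δ^tp_Y) = Δ^tp_X`).
[cite: MochizukiAbsTopI2012, Prop 4.10 (iii) p.60] -/
theorem fDelta_surjective_of_compactSpace (E : DeCuspidalization X Y) [CompactSpace X.PiTemp] :
    Function.Surjective E.fDelta := by
  intro y
  obtain ⟨x, hx⟩ := E.f_surjective_of_compactSpace (y : Y.PiTemp)
  have hxΔ : x ∈ X.DeltaTemp := by
    rw [← E.comap_deltaTemp, Subgroup.mem_comap]
    change E.f x ∈ Y.DeltaTemp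
    rw [hx]
    exact y.2
  exact ⟨⟨x, hxΔ⟩, Subtype.ext hx⟩

/-- Compact case: `Π^tp_Y = f(Π^tp_X)` is compact. [cite: MochizukiAbsTopI2012, Prop 4.10 (iii) p.60] -/
theorem compactSpace_piTemp_of_compactSpace (E : DeCuspidalization X Y) [CompactSpace X.PiTemp] : CompactSpace Y.PiTemp := by
  rw [← isCompact_univ_iff, ← (E.f_surjective_of_compactSpace).range_eq]
  exact isCompact_range E.f.continuous

/-- Compact case: `Δ^tp_Y = f(Δ^tp_X)` is compact. [cite: MochizukiAbsTopI2012, Prop 4.10 (iii) p.60] -/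
theorem compactSpace_deltaTemp_of_compactSpace (E : DeCuspidalization X Y) [CompactSpace X.PiTemp] :
    CompactSpace Y.DeltaTemp := by
  haveI : CompactSpace X.DeltaTemp := compactSpace_deltaTemp X
  rw [← isCompact_univ_iff, ← (E.fDelta_surjective_of_compactSpace).range_eq]
  exact isCompact_range E.fDelta.continuous

/-- Compact case: `Δ^tp_Y` is topologically finitely generated if `Δ^tp_X` is.
[cite: MochizukiAbsTopI2012, §0 p.8] -/
theorem isTopologicallyFinitelyGenerated_deltaTemp_of_compactSpace (E : DeCuspidalization X Y) [CompactSpace X.PiTemp]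
    (htfg : IsTopologicallyFinitelyGenerated X.DeltaTemp) :
    IsTopologicallyFinitelyGenerated Y.DeltaTemp :=
  htfg.of_denseRange E.fDelta (E.fDelta_surjective_of_compactSpace).denseRange

/-! ### The three residues in the compact case -/

/-- **Residue `hmin` in the compact case**: every Y-index is its own minimal co-free subgroup.
[cite: MochizukiAbsTopI2012, §0 p.8] -/
theorem hmin_of_compactSpace (E : DeCuspidalization X Y) [CompactSpace X.PiTemp] (H' : CharOpenSubgroup Y.DeltaTemp) :
    ∃ M, IsMinimalCofreeIn H'.toSubgroup M := by
  haveI : CompactSpace Y.DeltaTemp := E.compactSpace_deltaTemp_of_compactSpace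
  exact H'.exists_isMinimalCofreeIn_of_compactSpace

/-- **Residue (CF_Δ) in the compact case** (André's basis clause on `Δ^tp_Y`), from tfg of `Δ^tp_X`.
[cite: MochizukiAbsTopI2012, §0 p.9] -/
theorem cofreeCore_cofinal_delta_of_compactSpace (E : DeCuspidalization X Y) [CompactSpace X.PiTemp]
    (htfg : IsTopologicallyFinitelyGenerated X.DeltaTemp) (N : OpenNormalSubgroup Y.DeltaTemp) :
    ∃ H' : CharOpenSubgroup Y.DeltaTemp,
      (cofreeCore H'.toSubgroup).subgroupOf Y.DeltaTemp ≤ N.toSubgroup := by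
  haveI : CompactSpace Y.DeltaTemp := E.compactSpace_deltaTemp_of_compactSpace
  exact cofreeCore_cofinal_of_compactSpace
    (E.isTopologicallyFinitelyGenerated_deltaTemp_of_compactSpace htfg) N

/-- **Residue conj. 1 `hleft` of `CoFreeCofinalImAlong` in the compact case**: for every X-index `H`
the image `f(H) ≤ Δ^tp_Y` is closed of finite index, hence open, hence contains a Y-index `H′`, and
`K_Y(H′) = cl·ncl(toHat_Y H′^{co-fr}) ≤ cl·ncl(toHat_Y f(H)) = cl·ncl(f̂ toHat_X H^{co-fr}) = K_X(H)`
(`H^{co-fr} = H` by compactness). [cite: MochizukiAbsTopI2012, §0 p.8] -/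
theorem coFreeKernel_cofinal_left_of_compactSpace (E : DeCuspidalization X Y) [CompactSpace X.PiTemp]
    (htfg : IsTopologicallyFinitelyGenerated X.DeltaTemp) (H : CharOpenSubgroup X.DeltaTemp) :
    ∃ H' : CharOpenSubgroup Y.DeltaTemp,
      coFreeKernel ((ContinuousMonoidHom.id Y.PiHat).comp Y.toHat) H'.toSubgroup ≤
        coFreeKernel (E.fHat.comp X.toHat) H.toSubgroup := by
  classical
  haveI : CompactSpace X.DeltaTemp := compactSpace_deltaTemp X
  haveI : CompactSpace Y.DeltaTemp := E.compactSpace_deltaTemp_of_compactSpace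
  haveI : T2Space Y.PiTemp := Y.t2Space_piTemp
  have htfgY : IsTopologicallyFinitelyGenerated Y.DeltaTemp :=
    E.isTopologicallyFinitelyGenerated_deltaTemp_of_compactSpace htfg
  -- `V := f(H)`; its trace on `Δ^tp_Y` is the image of `H ∩ Δ^tp_X` under `Δ^tp_X → Δ^tp_Y`
  set V : Subgroup Y.PiTemp := H.toSubgroup.map E.f.toMonoidHom with hVdef
  have hVΔ : V.subgroupOf Y.DeltaTemp =
      (H.toSubgroup.subgroupOf X.DeltaTemp).map E.fDelta.toMonoidHom := by
    ext y
    constructor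
    · intro hy
      obtain ⟨h, hh, hhy⟩ := Subgroup.mem_map.mp (Subgroup.mem_subgroupOf.mp hy)
      refine Subgroup.mem_map.mpr ⟨⟨h, H.le hh⟩, Subgroup.mem_subgroupOf.mpr hh, ?_⟩
      exact Subtype.ext hhy
    · intro hy
      obtain ⟨x, hx, hxy⟩ := Subgroup.mem_map.mp hy
      refine Subgroup.mem_subgroupOf.mpr (Subgroup.mem_map.mpr ⟨(x : X.PiTemp),
        Subgroup.mem_subgroupOf.mp hx, ?_⟩)
      rw [← hxy]
      rfl
  haveI : (H.toSubgroup.subgroupOf X.DeltaTemp).FiniteIndex := H.finiteIndex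
  haveI hVfi : (V.subgroupOf Y.DeltaTemp).FiniteIndex := by
    rw [hVΔ]
    refine ⟨fun h0 => ?_⟩
    have hd := (H.toSubgroup.subgroupOf X.DeltaTemp).index_map_dvd
      (f := E.fDelta.toMonoidHom) E.fDelta_surjective_of_compactSpace
    rw [h0] at hd
    exact H.finiteIndex.index_ne_zero (Nat.eq_zero_of_zero_dvd hd)
  have hVc : IsClosed ((V.subgroupOf Y.DeltaTemp : Subgroup Y.DeltaTemp) : Set Y.DeltaTemp) := by
    rw [hVΔ, Subgroup.coe_map]
    have hHc : IsCompact ((H.toSubgroup.subgroupOf X.DeltaTemp : Subgroup X.DeltaTemp) :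
        Set X.DeltaTemp) :=
      (Subgroup.isClosed_of_isOpen _ H.isOpen).isCompact
    exact (hHc.image E.fDelta.continuous).isClosed
  have hVo : IsOpen ((V.subgroupOf Y.DeltaTemp : Subgroup Y.DeltaTemp) : Set Y.DeltaTemp) :=
    Subgroup.isOpen_of_isClosed_of_finiteIndex _ hVc
  obtain ⟨H', hH'⟩ := CharOpenSubgroup.exists_le htfgY V hVo
  refine ⟨H', ?_⟩
  -- kernel comparison inside `Q = Π̂_Y`
  refine Subgroup.topologicalClosure_mono (Subgroup.normalClosure_mono ?_)
  rintro _ ⟨y, hy, rfl⟩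
  have hyV : y ∈ V := hH' (cofreeCore_le _ hy)
  obtain ⟨h, hh, hhy⟩ := Subgroup.mem_map.mp hyV
  refine ⟨h, ?_, ?_⟩
  · rw [H.cofreeCore_eq_of_compactSpace]
    exact hh
  · change E.fHat (X.toHat h) = Y.toHat y
    rw [← E.toHat_comp h]
    exact congrArg Y.toHat hhy

/-! ### Node (iii), both clauses, in the compact case -/

/-- **[AbsTopI] Prop 4.10 (iii), Π-clause, AT THE CONSTRUCTION, COMPACT CASE** — for a
de-cuspidalization datum `E : X → Y` with `Π^tp_X` compact and `Δ^tp_X` topologically finitely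
generated (L3 parameter bundles `dX`, `dY`), the co-free completion of `Π^tp_X` with respect to
`Π̂_Y` is `Π^tp_Y`: all five residues of `prop410iiiAt_of_geometric_residues` are discharged.
[cite: MochizukiAbsTopI2012, Prop 4.10 (iii) p.60] -/
theorem prop410iiiAt_of_compactSpace (E : DeCuspidalization X Y) [CompactSpace X.PiTemp]
    (htfg : IsTopologicallyFinitelyGenerated X.DeltaTemp)
    (dX : X.GroupLevelData) (dY : Y.GroupLevelData) : Prop410iiiAt E :=
  prop410iiiAt_of_geometric_residues E (E.cofreeCore_cofinal_delta_of_compactSpace htfg)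
    (E.coFreeKernel_cofinal_left_of_compactSpace htfg) htfg dX dY E.hmin_of_compactSpace

/-- **[AbsTopI] Prop 4.10 (iii), Δ-clause, AT THE CONSTRUCTION, COMPACT CASE.**
[cite: MochizukiAbsTopI2012, Prop 4.10 (iii) p.60] -/
theorem prop410iiiDeltaAt_of_compactSpace (E : DeCuspidalization X Y) [CompactSpace X.PiTemp]
    (htfg : IsTopologicallyFinitelyGenerated X.DeltaTemp)
    (dX : X.GroupLevelData) (dY : Y.GroupLevelData) : Prop410iiiDeltaAt E :=
  prop410iiiDeltaAt_of_geometric_residues E (E.cofreeCore_cofinal_delta_of_compactSpace htfg)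
    (E.coFreeKernel_cofinal_left_of_compactSpace htfg) htfg dX dY E.hmin_of_compactSpace

/-- **Compact case, consequences of record**: `Δ^tp_X → Δ^tp_Y` has dense range (indeed is
surjective) and the reconstruction isomorphism `(Π^tp_X)^{Π̂_Y/co-fr} ≃ₜ* Π^tp_Y` over `f` is UNIQUE.
[cite: MochizukiAbsTopI2012, Prop 4.10 (iii) p.60] -/
theorem existsUnique_of_compactSpace (E : DeCuspidalization X Y) [CompactSpace X.PiTemp]
    (htfg : IsTopologicallyFinitelyGenerated X.DeltaTemp)
    (dX : X.GroupLevelData) (dY : Y.GroupLevelData) :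
    ∃! e : CoFreeCompletion (E.fHat.comp X.toHat) X.DeltaTemp ≃ₜ* Y.PiTemp,
      ∀ g : X.PiTemp, e (toCoFreeCompletion (E.fHat.comp X.toHat) X.DeltaTemp g) = E.f g :=
  Prop410iiiAt.existsUnique (E.prop410iiiAt_of_compactSpace htfg dX dY)

end DeCuspidalization

end Prop410

end Literature.AnabelianGeometry.AbsoluteAnabelian.AbsTopI

end
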